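import Summits.HubbardSuperconductivity.HubbardSuperconductivity.Theorems.AnisotropyChordTransferFibre3FinXC2Eval
import Summits.HubbardSuperconductivity.HubbardSuperconductivity.Theorems.AnisotropyChordTransferFibre3FinXDEvalW

/-!
# Route `AnisotropyChord` / H0 rotor rung: FIN per-`L` GM₃ certificates for `L ≥ 25` — the X3 evaluator layer (computable, zero data)

The per-`L` GM₃ certificate of g7 (`…FinXDGM3`/`…FinXDGM3b`, `9 ≤ L ≤ 24`) recomputes g5's two-propagator objects (`xbEval`,
`O(V²)`) THREE times per λ-cell (rows `N₁`+C, row D, side condition).  THIS FILE is the X3 architecture for `L ≥ 25`: the only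
two-propagator computation of a cell is the XBC2 combined certificate on two certified POINT-WEDGE literals (`…FinXB2Eval.tWedgePt`,
shared by adjacent cells), which additionally certifies a literal bracket `nt = (nlo, nhi)` of `T⁺ − 3λ₂ = ⟨Π⁰,C0⟩/‖Π⁰‖²`
(★ `FinXB.xbcnCellOK2` / `xbcnCellAnyT2` / `xbcnCellAny2`); the row-D certificate (★ `FinXD.xdCellN` / `xdCellOKN` / `xdCellAnyTN` /
`xdCellAnyN0`) and the side-condition certificate (★ `FinXD.sdDataN` / `sdOKzN` / `sdCellAnyZN`) take `nt` as an INPUT and compute no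
two-propagator object at all (row D: the XD point tables of `…FinXDEval` only).  The GM₃ cell list: `GCell3 = (λ·D, aD, c, bn, nlo, nhi)`,
`gmCellOK3` (the three facts of one cell), `cellsAllG3`, `cellsLastG3`, ★ `gmCheck3`.  SPLIT FORM (X4; the kernel work of one
`decide` is capped, so for `L ≥ 25` rows `N₁` and C are separate facts): ★ `FinXB.xbnCellOK2`/`xbnCellAny2` (row `N₁` exporting `nt`
AND the `T⁺·D` brackets `tb`), ★ `FinXB.xcObjT`/`xcCellOKT`/`xcCellAnyT0` (row C from GIVEN profile/gradient tables — certified literals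
— and `tb`; program identity `xcObjT_eq`), `GCell4`, `gmCellOK4`, `cellsAllG4`, `cellsLastG4`, ★ `gmCheck4`.  Program identity ★ `xdCellN_eq` (the row-D cell
data is g7's `xdCell` with the `nt` field replaced) lets the soundness files reuse g7's enclosure lemmas verbatim.
Soundness: `…FinX3SoundC` (combined + `nt`), `…FinX3SoundD` (row D), `…FinX3SoundS` (side), glue `…FinX3GM3`.
Prover seat `hubbard-h0-rotor-p3` g8; helper for piece A = stmt-HubbardSuperconductivity-23918 of rung 19089 (`--supports`, helper
class).  WHAT THIS IS NOT: nothing here proves superconductivity in the Hubbard model (rotor TARGET as worded stays FALSE, g15 verdict);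
evaluator infrastructure for the FIN certificates of ONE conditional reduction.  Tree imports only; no sorry, no new axioms.
-/

set_option linter.dupNamespace false
set_option autoImplicit false

namespace Summit.HubbardSuperconductivity.HubbardSuperconductivity.Theorems.AnisotropyChord.Transfer.Fibre3

namespace FinXB

open Hole2 FinCell

/-! ## Rows `N₁` + C with the `T⁺ − 3λ₂` bracket exported -/

/-- the objects' bracket of `T⁺ − 3λ₂ = Q/P` (XB2 objects from the two point wedges). -/
def ntOf2 (L : ℕ) (la lb : ℤ) (tlo thi : List (List Iv)) : Iv :=
  let O := (xbEval2 L la lb tlo thi).2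
  imul O.Q (iinv O.P)

/-- ★ THE COMBINED XBC2 CELL CERTIFICATE (rows `N₁` + C, constants `c`, `b = bn/bd`) AND the check that the literal interval `nt`
contains the objects' bracket of `T⁺ − 3λ₂`. -/
def xbcnCellOK2 (L : ℕ) (la lb : ℤ) (c : ℚ) (bn bd : ℕ) (nt : Iv) (tlo thi : List (List Iv)) : Bool :=
  xbcCellOK2 L la lb c bn bd tlo thi &&
    (decide (nt.1 ≤ (ntOf2 L la lb tlo thi).1) && decide ((ntOf2 L la lb tlo thi).2 ≤ nt.2))

/-- one cell, given the point wedges: vacuous (numerator / `Δ < 0` / `Δ > Δ₁`) or certified (with the `nt` export). -/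
def xbcnCellAnyT2 (L : ℕ) (d1 : ℚ) (bd : ℕ) (la lb : ℤ) (cb : ℚ × ℕ) (nt : Iv) (tlo thi : List (List Iv)) : Bool :=
  (denCellPos L (cosTab L) la lb && decide ((numIv L la lb).2 < 0) && decide (0 ≤ (G0Iv L la lb).1)) ||
  (groundCellCheck L la lb &&
    (decide ((deltaIv L la lb).2 < 0) || decide (d1 * (D : ℚ) < (((deltaIv L la lb).1 : ℤ) : ℚ)))) ||
  xbcnCellOK2 L la lb cb.1 cb.2 bd nt tlo thi

/-- ★ one cell with the point wedges recomputed (a kernel fact rewrites `tWedgePt L la`, `tWedgePt L lb` to certified literal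
tables and decides `xbcnCellAnyT2`). -/
def xbcnCellAny2 (L : ℕ) (d1 : ℚ) (bd : ℕ) (la lb : ℤ) (cb : ℚ × ℕ) (nt : Iv) : Bool :=
  xbcnCellAnyT2 L d1 bd la lb cb nt (tWedgePt L la) (tWedgePt L lb)

/-! ## Row `N₁` alone with the `T⁺ − 3λ₂` bracket AND the `T⁺` brackets exported (split form, row C certified separately) -/

/-- the objects' `T⁺·D` brackets `(tPlusLo, tPlusHi)` (XB2 objects from the two point wedges). -/
def tbOf2 (L : ℕ) (la lb : ℤ) (tlo thi : List (List Iv)) : ℤ × ℤ :=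
  let E := xbEval2 L la lb tlo thi
  (tPlusLo E.1 E.2, tPlusHi E.1 E.2)

/-- ★ THE ROW-`N₁` XB2 CELL CERTIFICATE (constant `c`) AND the checks that the literal interval `nt` contains the objects' bracket of
`T⁺ − 3λ₂` and that the literal pair `tb` contains the objects' `T⁺·D` brackets. -/
def xbnCellOK2 (L : ℕ) (la lb : ℤ) (c : ℚ) (nt : Iv) (tb : ℤ × ℤ) (tlo thi : List (List Iv)) : Bool :=
  xbCellOK2 L la lb c tlo thi &&
    (decide (nt.1 ≤ (ntOf2 L la lb tlo thi).1) && decide ((ntOf2 L la lb tlo thi).2 ≤ nt.2)) &&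
    (decide (tb.1 ≤ (tbOf2 L la lb tlo thi).1) && decide ((tbOf2 L la lb tlo thi).2 ≤ tb.2))

/-- one row-`N₁` cell, given the point wedges: vacuous or certified (with the `nt`, `tb` exports). -/
def xbnCellAnyT2 (L : ℕ) (d1 : ℚ) (la lb : ℤ) (c : ℚ) (nt : Iv) (tb : ℤ × ℤ) (tlo thi : List (List Iv)) : Bool :=
  (denCellPos L (cosTab L) la lb && decide ((numIv L la lb).2 < 0) && decide (0 ≤ (G0Iv L la lb).1)) ||
  (groundCellCheck L la lb &&
    (decide ((deltaIv L la lb).2 < 0) || decide (d1 * (D : ℚ) < (((deltaIv L la lb).1 : ℤ) : ℚ)))) ||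
  xbnCellOK2 L la lb c nt tb tlo thi

/-- ★ one row-`N₁` cell with the point wedges recomputed (kernel facts rewrite them to certified literal tables). -/
def xbnCellAny2 (L : ℕ) (d1 : ℚ) (la lb : ℤ) (c : ℚ) (nt : Iv) (tb : ℤ × ℤ) : Bool :=
  xbnCellAnyT2 L d1 la lb c nt tb (tWedgePt L la) (tWedgePt L lb)

/-! ## Row C alone from GIVEN profile / gradient tables and `T⁺` brackets (split form: the tables are certified literals) -/

/-- ★ the row-C objects of g5's `xcObj` with the profile table `ft`, the `x̂`-gradient table `gx` and the `T⁺·D` brackets `tb`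
as INPUTS (no two-propagator objects read). -/
def xcObjT (L : ℕ) (S : XBScal) (tb : ℤ × ℤ) (ft gx : List (List Iv)) : XCObj :=
  let V : ℕ := L * L
  let ct := cosTab L
  let Mz := xcM L ft
  let M : Iv := ipt Mz
  let M2 := imul M M
  let fnn2 := isqP (getF ft 1 0)
  let Q0 := xcQ0 L ft
  let Rb := xcRbar L gx
  let X := xcX L gx ct
  let Gam := iscale 2 (imul M2 (iadd Rb (iscale 2 fnn2)))
  let inner := imul (iscale 4 (imul Q0 X)) (imul Gam Rb)
  let chi := iadd (iadd (iscale 4 (imul (imul S.eps1 Q0) X))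
      (imul (imul S.eps1 Rb) (iadd Gam (iscale 2 (imul fnn2 M2)))))
      (iscale 2 (imul S.eps1 (isqrt inner)))
  let nhi := iadd (idivn (iscale 9 (imul M2 (xcPsi L gx))) 4) (iscale 12 (xcRowSum L ft gx))
  { M := Mz, chi := chi, nhi := nhi, tlo := tb.1, thi := tb.2, eta := idivn (iscale V S.lam) 4 }

/-- ★ program identity: with the recomputed tables and the objects' brackets, `xcObjT` is g5's `xcObj`. [folklore] -/
theorem xcObjT_eq (L : ℕ) (la lb : ℤ) (S : XBScal) (O : XBObj) :
    xcObjT L S (tPlusLo S O, tPlusHi S O) (fTab4 L la lb) (gTab4 L la lb) = xcObj L la lb S O := rfl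

/-- ★ THE ROW-C CELL CERTIFICATE from given tables and `T⁺` brackets (constant `b = bn/bd`): g4's ground-cell check, `1 − Δ > 0`,
`0 < bd`, the sup check of the profile table, `0 ≤ Tlo`, `Thi ≤ 2ε₁⁻`, `0 ≤ η⁻`, `(3√Chi⁺ + 3√Nhi⁺)² ≤ b·η⁻·(2ε₁⁻ − Thi)·3V²·Tlo`. -/
def xcCellOKT (L : ℕ) (la lb : ℤ) (bn bd : ℕ) (tb : ℤ × ℤ) (ft gx : List (List Iv)) : Bool :=
  let S := xbScal L la lb (gresCellTab L (cosTab L) la lb)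
  let C := xcObjT L S tb ft gx
  groundCellCheck L la lb && xbScalOK L la lb && decide (0 < bd) && xcMok L ft C.M && decide (0 ≤ C.tlo) &&
    decide (C.thi ≤ 2 * S.eps1.1) && decide (0 ≤ C.eta.1) && decide (sqSum C ≤ rhsLo L S C bn bd)

/-- one row-C cell, given the tables: vacuous or certified. -/
def xcCellAnyTT (L : ℕ) (d1 : ℚ) (bd : ℕ) (la lb : ℤ) (bn : ℕ) (tb : ℤ × ℤ) (ft gx : List (List Iv)) : Bool :=
  (denCellPos L (cosTab L) la lb && decide ((numIv L la lb).2 < 0) && decide (0 ≤ (G0Iv L la lb).1)) ||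
  (groundCellCheck L la lb &&
    (decide ((deltaIv L la lb).2 < 0) || decide (d1 * (D : ℚ) < (((deltaIv L la lb).1 : ℤ) : ℚ)))) ||
  xcCellOKT L la lb bn bd tb ft gx

/-- ★ one row-C cell with the tables recomputed (`fTab4`, `gTab4`; kernel facts rewrite them to certified literal tables). -/
def xcCellAnyT0 (L : ℕ) (d1 : ℚ) (bd : ℕ) (la lb : ℤ) (bn : ℕ) (tb : ℤ × ℤ) : Bool :=
  xcCellAnyTT L d1 bd la lb bn tb (fTab4 L la lb) (gTab4 L la lb)

end FinXB

namespace FinXD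

open Hole2 FinCell FinXB

/-! ## Row D with `nt` as an input -/

/-- ★ the XD cell data with the `T⁺ − 3λ₂` bracket `nt` as an INPUT: g7's `xdCell` with the scalars taken from `xbScal` directly
and no two-propagator objects computed. -/
def xdCellN (L : ℕ) (la lb : ℤ) (nt : Iv) (ptLo ptHi : XDPt) : XDCell :=
  let V : ℕ := L * L
  let ct := cosTab L
  let gt := gresCellTab L ct la lb
  let S := xbScal L la lb gt
  let cT : List Iv := (List.range keysQ.length).map fun i => ((getIv ptLo.tT i).1, (getIv ptHi.tT i).2)
  { L := L, lam := (la, lb), a := S.a, cs := S.cs, fnn := iadd S.a (idivn (iscale V (la, lb)) 4),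
    A := iadd (iconst (V : ℤ)) S.a,
    S1 := iscale V (G0Iv L la lb),
    gx := iadd (GresCellIv L la la 1 0) (imul (0, lb - la) (GresSlopeIv L la lb 1 0)),
    eps1 := S.eps1,
    nt := nt,
    gt := gt,
    cT := cT,
    cG3 := (List.range keys3.length).map fun i => ((getIv ptLo.tG3 i).1, (getIv ptHi.tG3 i).2),
    cW := (List.range keysQ.length).map fun i =>
      cwiden (ptLo.tW.getD i ((0, 0), (0, 0))) ((getIv cT i).2 - (getIv cT i).1),
    ct := ct, ct4 := cosTab (4 * L) }

/-- ★ program identity: `xdCellN` is g7's `xdCell` with the `nt` field replaced. [folklore] -/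
theorem xdCellN_eq (L : ℕ) (la lb : ℤ) (nt : Iv) (ptLo ptHi : XDPt) :
    xdCellN L la lb nt ptLo ptHi = { xdCell L la lb ptLo ptHi with nt := nt } := rfl

/-- ★ THE XD CELL CERTIFICATE with `nt` given: g4's ground-cell check, `1 − Δ > 0`, positive point denominators at `la`, nonnegative
point tables of `g` at both ends, every `den⁻ > 0`, `0 ≤ aD`, `T⁺⁻ = 3λ⁻ + nt⁻ ≥ 0`, and
`D·Σ|R̂′|²⁺/den⁻ ≤ aD · V² · (V λ⁻/4) · 3V² T⁺⁻ · D`. -/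
def xdCellOKN (L : ℕ) (la lb : ℤ) (aD : ℚ) (nt : Iv) (ptLo ptHi : XDPt) : Bool :=
  let C := xdCellN L la lb nt ptLo ptHi
  let s := C.lowGSum
  let V : ℚ := (((L : ℤ) * L : ℤ) : ℚ)
  let tlo : ℚ := ((3 * la + nt.1 : ℤ) : ℚ) / ((D : ℤ) : ℚ)
  let etalo : ℚ := V * (la : ℚ) / (4 * ((D : ℤ) : ℚ))
  groundCellCheck L la lb && xbScalOK L la lb && denCellPos L (cosTab L) la la && gPtNonneg L la && gPtNonneg L lb &&
    s.2 && decide (0 ≤ aD) && decide (0 ≤ tlo) &&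
    decide (s.1 ≤ aD * V ^ 2 * etalo * (3 * V ^ 2 * tlo) * ((D : ℤ) : ℚ))

/-- one row-D cell, given the point tables and `nt`: numerator-vacuous, `Δ`-vacuous on either side of `(0, Δ₁]`, or certified. -/
def xdCellAnyTN (L : ℕ) (d1 : ℚ) (la lb : ℤ) (aD : ℚ) (nt : Iv) (ptLo ptHi : XDPt) : Bool :=
  (denCellPos L (cosTab L) la lb && decide ((numIv L la lb).2 < 0) && decide (0 ≤ (G0Iv L la lb).1)) ||
  (groundCellCheck L la lb &&
    (decide ((deltaIv L la lb).2 < 0) || decide (d1 * (D : ℚ) < (((deltaIv L la lb).1 : ℤ) : ℚ)))) ||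
  xdCellOKN L la lb aD nt ptLo ptHi

/-- ★ one row-D cell with the XD point tables recomputed in the kernel. -/
def xdCellAnyN0 (L : ℕ) (d1 : ℚ) (la lb : ℤ) (aD : ℚ) (nt : Iv) : Bool :=
  xdCellAnyTN L d1 la lb aD nt (xdPoint L la) (xdPoint L lb)

/-! ## Side condition with `nt` as an input -/

/-- ★ the side-condition data with `T⁺ = 3λ + nt`, `nt` given (scalars from `xbScal`; no objects). -/
def sdDataN (L : ℕ) (la lb : ℤ) (bn bd : ℕ) (aD : ℚ) (nt : Iv) : SDData :=
  let S := xbScal L la lb (gresCellTab L (cosTab L) la lb)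
  let V : ℕ := L * L
  let tplus := iadd (iscale 3 (la, lb)) nt
  let c2 : Iv := idivn (iconst (((V * V : ℕ) : ℤ) - 5 * (V : ℤ) + 6)) (((V * V : ℕ) : ℤ))
  let m := isub (idivn (imul S.eps1 c2) 2) tplus
  let gap := isub (iscale 2 S.eps1) tplus
  let kap := imul (iscale 3 S.eps1) (iinv gap)
  let g0n := iadd (iscale 3 (isub ione S.delta)) m
  let g0d := iadd (iconst 3) m
  let g0 := imul g0n (iinv g0d)
  let fac := iadd ione (imul (imul kap S.delta) (iinv g0))
  let eta := idivn (iscale V (la, lb)) 4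
  let rho := iadd (iconst 2) (getIv (cosTab L) 1)
  { tplus := tplus, m := m, gap := gap, g0n := g0n, g0d := g0d, g0 := g0, fac := fac, eta := eta, rho := rho,
    lhs := imul (imul fac eta) (iadd (qIv aD) (imul (qIv ((bn : ℚ) / bd)) (iinv rho))) }

/-- ★ THE SIDE-CONDITION CERTIFICATE with `nt` given: regime `m ≥ 0` and `fac·η·(aD + b/ρ) < c` with the positivity of every
reciprocal. -/
def sdOKzN (L : ℕ) (la lb : ℤ) (c : ℚ) (bn bd : ℕ) (aD : ℚ) (nt : Iv) : Bool :=
  let Sd := sdDataN L la lb bn bd aD nt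
  groundCellCheck L la lb && xbScalOK L la lb && decide (0 < bd) &&
    decide (0 ≤ Sd.m.1) && decide (0 < Sd.gap.1) && decide (0 < Sd.g0n.1) && decide (0 < Sd.g0d.1) &&
    decide (0 < Sd.g0.1) && decide (0 < Sd.rho.1) && decide (((Sd.lhs.2 : ℤ) : ℚ) < c * (D : ℚ))

/-- one side-condition cell with constants `t = (c, bn, aD)` and `nt` given: vacuous or certified. -/
def sdCellAnyZN (L : ℕ) (d1 : ℚ) (bd : ℕ) (la lb : ℤ) (t : ℚ × ℕ × ℚ) (nt : Iv) : Bool :=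
  (denCellPos L (cosTab L) la lb && decide ((numIv L la lb).2 < 0) && decide (0 ≤ (G0Iv L la lb).1)) ||
  (groundCellCheck L la lb &&
    (decide ((deltaIv L la lb).2 < 0) || decide (d1 * (D : ℚ) < (((deltaIv L la lb).1 : ℤ) : ℚ)))) ||
  sdOKzN L la lb t.1 t.2.1 bd t.2.2 nt

/-! ## The GM₃ cell list -/

/-- a GM₃ cell of the X3 certificate: the point `λ·D` (the cell is `[lam, next point]`), its three constants, and the certified bracket
`(nlo, nhi)` of `T⁺ − 3λ₂` (scale `D`). -/
structure GCell3 where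
  /-- `λ·D` of the point -/
  lam : ℤ
  /-- row-D constant -/
  aD : ℚ
  /-- row-`N₁` constant -/
  c : ℚ
  /-- row-C numerator (`b = bn/bd`) -/
  bn : ℕ
  /-- `(T⁺ − 3λ₂)·D` lower end -/
  nlo : ℤ
  /-- `(T⁺ − 3λ₂)·D` upper end -/
  nhi : ℤ
  deriving DecidableEq

/-- the per-pair check: the combined rows-`N₁`+C cell (exporting `nt`), the row-D cell and the side condition (both reading `nt`). -/
def gmCellOK3 (L : ℕ) (d1 : ℚ) (bd : ℕ) (a : GCell3) (next : ℤ) : Bool :=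
  xbcnCellAny2 L d1 bd a.lam next (a.c, a.bn) (a.nlo, a.nhi) && xdCellAnyN0 L d1 a.lam next a.aD (a.nlo, a.nhi) &&
    sdCellAnyZN L d1 bd a.lam next (a.c, a.bn, a.aD) (a.nlo, a.nhi)

/-- all consecutive pairs pass. -/
def cellsAllG3 (L : ℕ) (d1 : ℚ) (bd : ℕ) : List GCell3 → Bool
  | [] => true
  | [_] => true
  | a :: b :: rest => gmCellOK3 L d1 bd a b.lam && cellsAllG3 L d1 bd (b :: rest)

/-- the last point. -/
def cellsLastG3 : List GCell3 → ℤ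
  | [] => 0
  | [a] => a.lam
  | _ :: b :: rest => cellsLastG3 (b :: rest)

/-- ★ THE PER-`L` GM₃ CERTIFICATE (X3 form) on `0 < Δ ≤ Δ₁`: points start at `0`, end `≥ lamTop L`, `0 < bd`, every pair passes. -/
def gmCheck3 (L : ℕ) (d1 : ℚ) (bd : ℕ) (cells : List GCell3) : Bool :=
  decide ((cells.head?.map GCell3.lam) = some 0) && decide (2 ≤ cells.length) && decide (lamTop L ≤ cellsLastG3 cells)
    && decide (0 < bd) && cellsAllG3 L d1 bd cells

/-! ## The GM₃ cell list, split form (rows `N₁` and C as separate facts) -/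

/-- a GM₃ cell of the X4 certificate: the point `λ·D`, the three constants, the certified bracket `(nlo, nhi)` of `T⁺ − 3λ₂` and the
certified `T⁺·D` brackets `(tlo, thi)` (both exported by the row-`N₁` fact, read by the other three facts). -/
structure GCell4 where
  /-- `λ·D` of the point -/
  lam : ℤ
  /-- row-D constant -/
  aD : ℚ
  /-- row-`N₁` constant -/
  c : ℚ
  /-- row-C numerator (`b = bn/bd`) -/
  bn : ℕ
  /-- `(T⁺ − 3λ₂)·D` lower end -/
  nlo : ℤ
  /-- `(T⁺ − 3λ₂)·D` upper end -/
  nhi : ℤ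
  /-- `T⁺·D` lower bracket -/
  tlo : ℤ
  /-- `T⁺·D` upper bracket -/
  thi : ℤ
  deriving DecidableEq

/-- the per-pair check (split form): row `N₁` (exporting `nt`, `tb`), row C (reading `tb`), row D and the side condition (reading `nt`). -/
def gmCellOK4 (L : ℕ) (d1 : ℚ) (bd : ℕ) (a : GCell4) (next : ℤ) : Bool :=
  xbnCellAny2 L d1 a.lam next a.c (a.nlo, a.nhi) (a.tlo, a.thi) && xcCellAnyT0 L d1 bd a.lam next a.bn (a.tlo, a.thi) &&
    xdCellAnyN0 L d1 a.lam next a.aD (a.nlo, a.nhi) && sdCellAnyZN L d1 bd a.lam next (a.c, a.bn, a.aD) (a.nlo, a.nhi)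

/-- all consecutive pairs pass (split form). -/
def cellsAllG4 (L : ℕ) (d1 : ℚ) (bd : ℕ) : List GCell4 → Bool
  | [] => true
  | [_] => true
  | a :: b :: rest => gmCellOK4 L d1 bd a b.lam && cellsAllG4 L d1 bd (b :: rest)

/-- the last point (split form). -/
def cellsLastG4 : List GCell4 → ℤ
  | [] => 0
  | [a] => a.lam
  | _ :: b :: rest => cellsLastG4 (b :: rest)

/-- ★ THE PER-`L` GM₃ CERTIFICATE (X4 split form) on `0 < Δ ≤ Δ₁`: points start at `0`, end `≥ lamTop L`, `0 < bd`, every pair passes. -/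
def gmCheck4 (L : ℕ) (d1 : ℚ) (bd : ℕ) (cells : List GCell4) : Bool :=
  decide ((cells.head?.map GCell4.lam) = some 0) && decide (2 ≤ cells.length) && decide (lamTop L ≤ cellsLastG4 cells)
    && decide (0 < bd) && cellsAllG4 L d1 bd cells

end FinXD

end Summit.HubbardSuperconductivity.HubbardSuperconductivity.Theorems.AnisotropyChord.Transfer.Fibre3
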